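import Summits.QuantumFields.BalabanUV.T4Continuum.Support.SubstrateSlotsOfRecord
import Summits.QuantumFields.BalabanUV.T4Continuum.Support.B13StepOfRecordSecantStructuralUniform

/-!
# NE5 ∕ U3 — E8[rec] AT THE SUBSTRATE's SLOTS OF RECORD: the structural secant END of record (p214566 → R20 re-point p217039 → η-uniform
# p219431) INSTANTIATED at `S₀ := SubstrateSlotsOfRecord.slotsOfRecord …` (substrate-p1, p220104; MAP §O1 O-8 «NE5's O1 instance =
# `B13StepOfRecord.assembly (slotsOfRecord …)`») on R20's operator carrier OF RECORD `M := B13OpMeasurable.measOp`, with the END-face binders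
# that the instance settles DISCHARGED BY NAME or REDUCED TO LETTER CONDITIONS, every other binder displayed VERBATIM

Cell `pub-balaban`, unit `b2b-balaban-t4-ne5-formalise-leaf-01` (NE5 formalisation swarm, LEAF PROVER 01, gen 11).  A FOLLOWER of this lineage's
E8[rec] faces (p217039 `…Sub.ne5_of_record_restrict_secant_structural`, p219431 `…Uniform.uniform_ne5_of_record_restrict_secant_structural`)
consuming substrate-p1's `SubstrateSlotsOfRecord` (p220104), route P2's `B13OpMeasurable.measOp`∕`assemble_mem_measOp`, leaf-03's
`B13StepOfRecordSub.opA_mem_measOp`∕`opB_mem_measOp` and O1-e's `B13Represents.Assembly.transportReads_of_insOpAt` BY NAME; nothing landed is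
edited; 0 `def`, 0 cite tag (Summits-side NEW WORK under the LEAN PLACEMENT RULE — cell bookkeeping).
HONEST FRAMING: rung (B)+1 of the FINITE-VOLUME T⁴ continuum programme — NOT infinite volume, NOT a mass gap, NOT the Clay problem, and
**NOT A PROOF OF NE5**: every analytic input of E8[rec] (row NE2's entry-currency rate `WeightedEntrywiseRate`, the one-run sizes `RawBounded`,
the quoted levels `DecayBound`, the slice budgets, the insertion-operator structure `InsOpComposition` + membership + `InsOpRate`, the W2-op
binder `ActOpFibre` with its decay split + (2.38) shape, the history-side `ActExpLinearOn`∕`ActExpNormBound`∕`ActAbsBound` with decay split +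
(2.38) shape, radii, numerics) stays a DISPLAYED HYPOTHESIS, now ABOUT THE SUBSTRATE's LETTERS (`SlotLetters`: factor letters `A`, weights `W`,
contour systems `ΓA∕ΓB`, kernel∕potential tables `dkA…pRB`, insertion letters `ins`, margins `rOp∕rHist`); nothing printed is asserted and the
substrate's instance is NOT claimed to satisfy any of them.  WHAT THE INSTANCE SETTLES (decls, not adjectives):
* §1 **`opA_mem_measOp_slotsOfRecord` ∕ `opB_mem_measOp_slotsOfRecord`** — the sub-slot MEMBERSHIP side conditions `hMA`∕`hMB` of EVERY
  restricted END face of record (`B13StepEndOn.ne5_of_record_restrict_loc`, `B13StepEndLoc.ne5_of_record_restrict_gaussianParamBi_mass`,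
  `B13AssemblyCoresEnd[RestrictRecord]`, E8[rec] and their η-uniform forms) AT `S₀ := slotsOfRecord …`, `M := measOp`: VERBATIM their
  hypothesis `∀ g V k, opOf S₀.F S₀.rawA g V k ∈ measOp …` (resp. `rawB`), FROM three LETTER conditions per run — format-boundedness of the raw
  record, measurability in the field argument `x` of the two potential tables `pQ∕pR` — the formats' potential weights `w(Y)k(b,b′)∕|τ(Y)|`,
  `v(Y)∕|τ(Y)|` being `x`-free BY CONSTRUCTION of `B13Weights.wt` (`measurable_const`).
* §2 **THE L01 READING AT THE INSTANCE.** `transportReads_slotsOfRecord_iff`: `(assembly (slotsOfRecord …)).TransportReads W` IS (`Iff.rfl`) the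
  condition «`L.ins.iopA (g (k−1)) U k = L.ins.iopA (g (k−1)) U′ k` whenever `transport U = transport U′`» on the insertion LETTER `iopA`, which
  `SubstrateSlotsOfRecord.InsLetters` types on run B's backgrounds — NOT by construction at the instance as filed (located interface point
  F-ne5leaf01g11-1, GAPS.md C-ne5leaf01-56; a typed junction, not an objection); `transportReads_slotsOfRecord_of_factor`: it HOLDS as soon as
  `iopA` FACTORS through the transport (`iopA r U k = iopAt r (transport U) k`, `iopAt` on run A's own backgrounds) — `transportReads_of_insOpAt`.
* §3 **`ne5_of_substrate_restrict_secant_structural`** — E8[rec] (p217039 §3) AT THE INSTANCE: `hMA`∕`hMB` REPLACED by §1's six letter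
  conditions, `hT` by §2's factorisation datum, the scalar letters read off `L` (`rOp`, `rHist`, `ins.ω`), every other binder VERBATIM;
  conclusion LITERALLY `NE5 (B13StepOfRecord.outA (slotsOfRecord …) E₀ cB) (B13StepOfRecord.outB (slotsOfRecord …) E₀ cB) W κ θ′ C₅`, p214566's
  `C₅` VERBATIM — the E8[rec] twin of the cores road's record face `B13AssemblyCoresEndRestrictRecord.ne5_slotsOfRecord_cores_actNorm`
  (leaf-08-g5, p221018), whose displayed `hMA`∕`hMB` (at `M := measOp`) and `hT` are exactly what §1∕§2 discharge.
* §4 **`uniform_ne5_of_substrate_restrict_secant_structural`** — the η-UNIFORM form (p219431 §2 at the instance): ONE constant for EVERY driven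
  two-run object `D`, representation `ι`, letters `c a s`, frame `P`, factor index data and EVERY letter package `L` with `L.ins.ω = ω`.
CENSUS vs p217039 §3 (binders, by name): MINUS = [hMA, hMB, hT]; PLUS = [hbdA, hmQA, hmRA, hbdB, hmQB, hmRB, iopAt, hiopA]; rest IDENTICAL
(specialised).  HONEST DEPENDENCY (cell line, verbatim): continuum YM on T⁴ ⇐ BetaPertH ∧ nine spine estimates (0/9 proved); BetaPertH ⇐ (D1) ∧
(D4) ∧ CAP+tail; G-an2-4 gates asym, D1 and NE2/3/4.  0 sorry; axioms ⊆ {propext, Classical.choice, Quot.sound}.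
-/

noncomputable section

open Metric Set MeasureTheory

namespace Summit.QuantumFields.BalabanUV.T4Continuum.B13StepOfRecordSubstrate

open Literature.MathematicalPhysics.QuantumFieldTheory.Balaban1983to89
open Literature.MathematicalPhysics.QuantumFieldTheory.Balaban1983to89.T4OutputRate (DecayBound NE5)
open Literature.MathematicalPhysics.QuantumFieldTheory.Balaban1983to89.T4InputCauchyRateSpecies (ballClass)
open Literature.MathematicalPhysics.QuantumFieldTheory.Balaban1983to89.B5Prop11Plancherel (Tor)
open Summit.QuantumFields.BalabanUV.T4Continuum.B13Carriers (TwoRuns)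
open Summit.QuantumFields.BalabanUV.T4Continuum.B13OpDatum (OpDatum Species FormatBounded B13Weights)
open Summit.QuantumFields.BalabanUV.T4Continuum.B13OpDatumJunctions (opOf RawBounded WeightedEntrywiseRate)
open Summit.QuantumFields.BalabanUV.T4Continuum.B13OpMeasurable (measOp)
open Summit.QuantumFields.BalabanUV.T4Continuum.B13HistMeasurable (MeasPotFrame B13HistM)
open Summit.QuantumFields.BalabanUV.T4Continuum.B13StepTermLabels (InnerLabel)
open Summit.QuantumFields.BalabanUV.T4Continuum.B13StepTermFamily (ActData ActExpLinearOn)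
open Summit.QuantumFields.BalabanUV.T4Continuum.B13StepTermSocket (labelsIndexing)
open Summit.QuantumFields.BalabanUV.T4Continuum.B13InnerData (Bnd b13InnerData)
open Summit.QuantumFields.BalabanUV.T4Continuum.UrsellTermBudget (actSum)
open Summit.QuantumFields.BalabanUV.T4Continuum.B13TermHistSecant (ActExpNormBound ActAbsBound)
open Summit.QuantumFields.BalabanUV.T4Continuum.B13DomainGeometryTR (domainGeometry)
open Summit.QuantumFields.BalabanUV.T4Continuum.B13Base (selfCtr)
open Summit.QuantumFields.BalabanUV.T4Continuum.B13StepOfRecord (Slots assembly step)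
open Summit.QuantumFields.BalabanUV.T4Continuum.OutputRateActOpFibre (ActOpFibre)
open Summit.QuantumFields.BalabanUV.T4Continuum.OutputRateInsertionStructural (InsOpComposition)
open Summit.QuantumFields.BalabanUV.T4Continuum.B13StepOfRecordSub (assemblyOn stepOn restrict opA_mem_measOp opB_mem_measOp)
open Summit.QuantumFields.BalabanUV.T4Continuum.B13StepOfRecordSecantStructuralSub (ne5_of_record_restrict_secant_structural)
open Summit.QuantumFields.BalabanUV.T4Continuum.B13StepOfRecordSecantStructuralUniform (uniform_ne5_of_record_restrict_secant_structural)
open Summit.QuantumFields.BalabanUV.T4Continuum.SubstrateBackgroundTransporters (unitMod)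
open Summit.QuantumFields.BalabanUV.T4Continuum.SubstrateTwoRunsDriven (DrivenRuns)
open Summit.QuantumFields.BalabanUV.T4Continuum.SubstrateRawSpecies (rawAOfRecord rawBOfRecord)
open Summit.QuantumFields.BalabanUV.T4Continuum.SubstrateSlotsOfRecord (SpeciesRec SlotLetters slotsOfRecord)

section Letters

variable {G : Type} [GaugeGroup G] (D : DrivenRuns G)
variable {o : Type} [Fintype o] [DecidableEq o] (ι : G →* Matrix o o ℂ) (c : ℂ) (a : ℝ) (s : ℕ → ℂ)
variable {T ι' S Ω 𝒴 : Type} (P : MeasPotFrame D.carriers) {IOp : Type*}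
  (𝒵 : D.carriers.Dom → InnerLabel D.carriers.Dom (Bnd D.toTwoRuns) → Type) [∀ Z j, Fintype (𝒵 Z j)] (dom : ∀ Z j, 𝒵 Z j → D.carriers.Dom)
  (Jc : D.carriers.Dom → InnerLabel D.carriers.Dom (Bnd D.toTwoRuns) → Type) [∀ Z j, Fintype (Jc Z j)]
  (V : D.carriers.Dom → InnerLabel D.carriers.Dom (Bnd D.toTwoRuns) → Type) [∀ Z j, NormedAddCommGroup (V Z j)]
  [∀ Z j, InnerProductSpace ℝ (V Z j)] [∀ Z j, MeasurableSpace (V Z j)] [∀ Z j, BorelSpace (V Z j)] [∀ Z j, FiniteDimensional ℝ (V Z j)]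
  (mI : D.carriers.Dom → InnerLabel D.carriers.Dom (Bnd D.toTwoRuns) → Type) [∀ Z j, Fintype (mI Z j)] [∀ Z j, DecidableEq (mI Z j)]
variable (L : SlotLetters D (o := o) (T := T) (ι' := ι') (S := S) (Ω := Ω) (𝒴 := 𝒴) P (IOp := IOp) 𝒵 dom Jc V mI)

/-! ## §1 The sub-slot membership side conditions `hMA`∕`hMB` at the instance, from letter conditions -/

section MeasOp

variable [MeasurableSpace Ω]

/-- [folklore] **RUN A's OPERATOR DATA OF THE SUBSTRATE INSTANCE LIE IN THE MEASURABLE SLOT** — VERBATIM the hypothesis `hMA` of every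
restricted END face of record at `S₀ := slotsOfRecord …`, `M := measOp` — from three LETTER conditions: run A's raw record is format-bounded
(a one-run size, displayed) and its two potential tables `pQA r U k · Y b b′`, `pRA r U k · Y` are measurable in the field argument `x`; the
formats' potential weights are `x`-free by construction of `B13Weights.wt`.  Leaf-03's `opA_mem_measOp` (route P2's `assemble_mem_measOp`) BY NAME. -/
theorem opA_mem_measOp_slotsOfRecord
    (hbdA : ∀ (g : ℕ → ℝ) (U : D.carriers.BgA) (k : ℕ),
      FormatBounded (L.W k).format (rawAOfRecord ι D c a s L.ΓA L.dkA L.gcA L.pQA L.pRA g U k).kernel)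
    (hmQA : ∀ (r : ℝ) (U : GaugeField (D.F.P D.K) 0 G) (k : ℕ) (Y : 𝒴) (b b' : ((Tor (unitMod (D.F.P D.K)) × Fin (D.F.P D.K).d) × o)),
        Measurable fun x : Ω => L.pQA r U k x Y b b')
    (hmRA : ∀ (r : ℝ) (U : GaugeField (D.F.P D.K) 0 G) (k : ℕ) (Y : 𝒴), Measurable fun x : Ω => L.pRA r U k x Y) :
    ∀ (g : ℕ → ℝ) (U : D.carriers.BgA) (k : ℕ), opOf (slotsOfRecord D ι c a s P 𝒵 dom Jc V mI L).F
        (slotsOfRecord D ι c a s P 𝒵 dom Jc V mI L).rawA g U k ∈ measOp T ((Tor (unitMod (D.F.P D.K)) × Fin (D.F.P D.K).d) × o) ι' Ω 𝒴 :=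
  opA_mem_measOp (slotsOfRecord D ι c a s P 𝒵 dom Jc V mI L) hbdA (fun g U k Y b b' => hmQA (g (k - 1)) U.1 k Y b b')
    (fun g U k Y => hmRA (g (k - 1)) U.1 k Y) (fun _ _ _ _ => measurable_const) (fun _ _ => measurable_const)

/-- [folklore] **RUN B's OPERATOR DATA OF THE SUBSTRATE INSTANCE LIE IN THE MEASURABLE SLOT** — VERBATIM `hMB` at the instance, from the
run-B letter conditions. -/
theorem opB_mem_measOp_slotsOfRecord
    (hbdB : ∀ (g : ℕ → ℝ) (U : D.carriers.BgB) (k : ℕ),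
      FormatBounded (L.W k).format (rawBOfRecord ι D c a s L.ΓB L.dkB L.gcB L.pQB L.pRB g U k).kernel)
    (hmQB : ∀ (r : ℝ) (U : GaugeField (D.F.P (D.K + 1)) 0 G) (k : ℕ) (Y : 𝒴) (b b' : ((Tor (unitMod (D.F.P D.K)) × Fin (D.F.P D.K).d) × o)),
        Measurable fun x : Ω => L.pQB r U k x Y b b')
    (hmRB : ∀ (r : ℝ) (U : GaugeField (D.F.P (D.K + 1)) 0 G) (k : ℕ) (Y : 𝒴), Measurable fun x : Ω => L.pRB r U k x Y) :
    ∀ (g : ℕ → ℝ) (U : D.carriers.BgB) (k : ℕ), opOf (slotsOfRecord D ι c a s P 𝒵 dom Jc V mI L).F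
        (slotsOfRecord D ι c a s P 𝒵 dom Jc V mI L).rawB g U k ∈ measOp T ((Tor (unitMod (D.F.P D.K)) × Fin (D.F.P D.K).d) × o) ι' Ω 𝒴 :=
  opB_mem_measOp (slotsOfRecord D ι c a s P 𝒵 dom Jc V mI L) hbdB (fun g U k Y b b' => hmQB (g (k - 1)) U.1 k Y b b')
    (fun g U k Y => hmRB (g (k - 1)) U.1 k Y) (fun _ _ _ _ => measurable_const) (fun _ _ => measurable_const)

end MeasOp

/-! ## §2 The L01 reading `TransportReads` at the instance -/

/-- [folklore] **THE L01 READING AT THE SUBSTRATE INSTANCE, UNFOLDED** (`Iff.rfl`): `TransportReads W` for the assembly of the slots of record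
IS the condition that run A's insertion-operator LETTER `iopA`, typed by `SubstrateSlotsOfRecord.InsLetters` on run B's backgrounds, depends on
the run-B background only through the transport.  NOT by construction at the instance as filed (located interface point F-ne5leaf01g11-1). -/
theorem transportReads_slotsOfRecord_iff (W : Set (ℕ → ℝ)) :
    (assembly (slotsOfRecord D ι c a s P 𝒵 dom Jc V mI L)).TransportReads W ↔
      ∀ g ∈ W, ∀ U U' : D.carriers.BgB, D.carriers.transport U = D.carriers.transport U' →
        ∀ k : ℕ, L.ins.iopA (g (k - 1)) U k = L.ins.iopA (g (k - 1)) U' k :=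
  Iff.rfl

/-- [folklore] **THE L01 READING HOLDS AT THE INSTANCE AS SOON AS `iopA` FACTORS THROUGH THE TRANSPORT** — a table `iopAt` on run A's OWN
backgrounds with `iopA r U k = iopAt r (transport U) k` (the form O-8 describes: «run A's through the transporter exactly as `rawAOfRecord`»);
O1-e's `transportReads_of_insOpAt` BY NAME. -/
theorem transportReads_slotsOfRecord_of_factor (iopAt : ℝ → D.carriers.BgA → ℕ → IOp)
    (hiopA : ∀ (r : ℝ) (U : D.carriers.BgB) (k : ℕ), L.ins.iopA r U k = iopAt r (D.carriers.transport U) k) (W : Set (ℕ → ℝ)) :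
    (assembly (slotsOfRecord D ι c a s P 𝒵 dom Jc V mI L)).TransportReads W :=
  (assembly (slotsOfRecord D ι c a s P 𝒵 dom Jc V mI L)).transportReads_of_insOpAt (insOpA' := fun g U k => iopAt (g (k - 1)) U k)
    (fun g U k => hiopA (g (k - 1)) U k) W

/-! ## §3 E8[rec] structural AT THE SUBSTRATE's SLOTS OF RECORD on the measurable operator carrier -/

section Instance

variable [MeasurableSpace Ω] [NormedAddCommGroup IOp] [NormedSpace ℂ IOp]

/-- [folklore] **E8[rec] (STRUCTURAL SECANT END OF RECORD) AT THE SUBSTRATE's O1 INSTANCE** — p217039 §3 `ne5_of_record_restrict_secant_structural`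
at `S₀ := slotsOfRecord D ι c a s P 𝒵 dom Jc V mI L`, `M := measOp`: the membership side conditions from §1's six LETTER conditions, the L01 reading
from §2's factorisation datum `(iopAt, hiopA)`, margins and age damping read off the letters (`L.rOp`, `L.rHist`, `L.ins.ω`); EVERY OTHER BINDER of
p217039 §3 VERBATIM at the instance (now about the substrate's letters; `ActOpFibre` for the cores of record `actOfLetters …` read through
`↥measOp → OpDatum`); conclusion LITERALLY `NE5 (B13StepOfRecord.outA (slotsOfRecord …) E₀ cB) (B13StepOfRecord.outB (slotsOfRecord …) E₀ cB) W κ θ′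
C₅`, p214566's `C₅` VERBATIM.  NOT a proof of NE5; nothing of the substrate's letters is asserted. -/
theorem ne5_of_substrate_restrict_secant_structural (E₀ cB : ℝ) {W : Set (ℕ → ℝ)} {ROp RHist : ℕ → ℝ}
    {N A A' Aop Aop' : ℕ → (ℕ → ℝ) → D.toTwoRuns.carriers.BgB → D.toTwoRuns.carriers.Dom →
      InnerLabel D.toTwoRuns.carriers.Dom (Bnd D.toTwoRuns) → ℝ}
    {Dt : ActData D.toTwoRuns.carriers.Dom (InnerLabel D.toTwoRuns.carriers.Dom (Bnd D.toTwoRuns))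
      (measOp T ((Tor (unitMod (D.F.P D.K)) × Fin (D.F.P D.K).d) × o) ι' Ω 𝒴) (B13HistM P) Ω}
    {κ Nbar ε εop Rt EA₀ E₁ cA c₁ r₀ Gi δI ρ₁ θ θ' ρ₀ B : ℝ} {k₀ k₁ : ℕ} (rI : ℕ → ℝ) (hrI : ∀ k, 0 < rI k)
    {Cfg : ℕ → Type*} [∀ k, NormedAddCommGroup (Cfg k)] [∀ k, NormedSpace ℂ (Cfg k)] {cfg : ∀ k, IOp → Cfg k}
    {Φ : ∀ k, (D.toTwoRuns.carriers.Dom → ℝ) → Cfg k → B13HistM P} {𝒪 : ℕ → (ℕ → ℝ) → D.toTwoRuns.carriers.BgB → Set IOp}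
    {Dc : ∀ k, (ℕ → ℝ) → D.toTwoRuns.carriers.BgB → Set (Cfg k)}
    -- §1's letter conditions (replace `hMA` ∕ `hMB`)
    (hbdA : ∀ (g : ℕ → ℝ) (U : D.carriers.BgA) (k : ℕ),
      FormatBounded (L.W k).format (rawAOfRecord ι D c a s L.ΓA L.dkA L.gcA L.pQA L.pRA g U k).kernel)
    (hmQA : ∀ (r : ℝ) (U : GaugeField (D.F.P D.K) 0 G) (k : ℕ) (Y : 𝒴) (b b' : ((Tor (unitMod (D.F.P D.K)) × Fin (D.F.P D.K).d) × o)),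
        Measurable fun x : Ω => L.pQA r U k x Y b b')
    (hmRA : ∀ (r : ℝ) (U : GaugeField (D.F.P D.K) 0 G) (k : ℕ) (Y : 𝒴), Measurable fun x : Ω => L.pRA r U k x Y)
    (hbdB : ∀ (g : ℕ → ℝ) (U : D.carriers.BgB) (k : ℕ),
      FormatBounded (L.W k).format (rawBOfRecord ι D c a s L.ΓB L.dkB L.gcB L.pQB L.pRB g U k).kernel)
    (hmQB : ∀ (r : ℝ) (U : GaugeField (D.F.P (D.K + 1)) 0 G) (k : ℕ) (Y : 𝒴) (b b' : ((Tor (unitMod (D.F.P D.K)) × Fin (D.F.P D.K).d) × o)),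
        Measurable fun x : Ω => L.pQB r U k x Y b b')
    (hmRB : ∀ (r : ℝ) (U : GaugeField (D.F.P (D.K + 1)) 0 G) (k : ℕ) (Y : 𝒴), Measurable fun x : Ω => L.pRB r U k x Y)
    -- §2's factorisation datum (replaces `hT`)
    (iopAt : ℝ → D.carriers.BgA → ℕ → IOp)
    (hiopA : ∀ (r : ℝ) (U : D.carriers.BgB) (k : ℕ), L.ins.iopA r U k = iopAt r (D.carriers.transport U) k)
    -- p217039 §3's binders VERBATIM at the instance
    (hbB : (assembly (slotsOfRecord D ι c a s P 𝒵 dom Jc V mI L)).SliceBudgetB W κ cB)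
    (hbA : (slotsOfRecord D ι c a s P 𝒵 dom Jc V mI L).D.SliceBudget (step (slotsOfRecord D ι c a s P 𝒵 dom Jc V mI L) E₀ cB) W κ cA)
    (hdA : DecayBound (B13StepOfRecord.outA (slotsOfRecord D ι c a s P 𝒵 dom Jc V mI L) E₀ cB) W EA₀ κ)
    (hdB : DecayBound (B13StepOfRecord.outB (slotsOfRecord D ι c a s P 𝒵 dom Jc V mI L) E₀ cB) W E₀ κ)
    (hRA : RawBounded (slotsOfRecord D ι c a s P 𝒵 dom Jc V mI L).F (assembly (slotsOfRecord D ι c a s P 𝒵 dom Jc V mI L)).rawAt W)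
    (hRB : RawBounded (slotsOfRecord D ι c a s P 𝒵 dom Jc V mI L).F (slotsOfRecord D ι c a s P 𝒵 dom Jc V mI L).rawB W)
    (hwer : WeightedEntrywiseRate (slotsOfRecord D ι c a s P 𝒵 dom Jc V mI L).F (assembly (slotsOfRecord D ι c a s P 𝒵 dom Jc V mI L)).rawAt
      (slotsOfRecord D ι c a s P 𝒵 dom Jc V mI L).rawB W c₁
      fun k => θ ^ k) (hfl : ∀ k, r₀ ≤ L.rOp k)
    (hcomp : InsOpComposition ((slotsOfRecord D ι c a s P 𝒵 dom Jc V mI L).D.toInsOpModel (step (slotsOfRecord D ι c a s P 𝒵 dom Jc V mI L) E₀ cB)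
      rI hrI)
      W κ E₀ Gi cfg Φ 𝒪 Dc)
    (hIA : ∀ k, ∀ g ∈ W, ∀ (U : D.toTwoRuns.carriers.BgB),
      ((slotsOfRecord D ι c a s P 𝒵 dom Jc V mI L).D.toInsOpModel (step (slotsOfRecord D ι c a s P 𝒵 dom Jc V mI L) E₀ cB)
        rI hrI).opIA g U k ∈ 𝒪 k g U)
    (hirate : ((slotsOfRecord D ι c a s P 𝒵 dom Jc V mI L).D.toInsOpModel (step (slotsOfRecord D ι c a s P 𝒵 dom Jc V mI L) E₀ cB)
      rI hrI).InsOpRate W δI θ)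
    (hδI : 0 ≤ δI) (hGi : 0 ≤ Gi) (hρ₁ : ρ₁ < 1) (hreachI : δI * θ ^ k₁ ≤ ρ₁)
    (hfib : ActOpFibre (labelsIndexing (domainGeometry D.toTwoRuns) (b13InnerData D.toTwoRuns))
      (restrict (slotsOfRecord D ι c a s P 𝒵 dom Jc V mI L) (measOp T ((Tor (unitMod (D.F.P D.K)) × Fin (D.F.P D.K).d) × o) ι' Ω 𝒴)
          (opA_mem_measOp_slotsOfRecord D ι c a s P 𝒵 dom Jc V mI L hbdA hmQA hmRA)
        (opB_mem_measOp_slotsOfRecord D ι c a s P 𝒵 dom Jc V mI L hbdB hmQB hmRB)).act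
      (stepOn (restrict (slotsOfRecord D ι c a s P 𝒵 dom Jc V mI L) (measOp T ((Tor (unitMod (D.F.P D.K)) × Fin (D.F.P D.K).d) × o) ι' Ω 𝒴)
          (opA_mem_measOp_slotsOfRecord D ι c a s P 𝒵 dom Jc V mI L hbdA hmQA hmRA)
        (opB_mem_measOp_slotsOfRecord D ι c a s P 𝒵 dom Jc V mI L hbdB hmQB hmRB)) E₀ cB) W Aop)
    (hAop0 : ∀ k g U Z ℓ, 0 ≤ Aop k g U Z ℓ) (hAop0' : ∀ k g U Z ℓ, 0 ≤ Aop' k g U Z ℓ)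
    (hdecop : ∀ k g U Z ℓ, Aop k g U Z ℓ ≤ Aop' k g U Z ℓ * Real.exp (-(κ * (D.toTwoRuns.carriers.d Z + 5)))) (hεop : 0 ≤ εop)
    (h238op : ∀ k, ∀ g ∈ W, ∀ (U : D.toTwoRuns.carriers.BgB), ∀ Z ∈ D.toTwoRuns.domAt k,
      actSum (b13InnerData D.toTwoRuns) (Aop' k g U) k Z ≤ εop * Real.exp (-(Rt * D.toTwoRuns.carriers.d Z)))
    (hΦopsmall : 36 * (εop * Real.exp 64 * B12TreeDecay.K₀ (4 * 2 ^ 4) (2 * 4)) < 1)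
    (hexp : ActExpLinearOn (labelsIndexing (domainGeometry D.toTwoRuns) (b13InnerData D.toTwoRuns))
      (restrict (slotsOfRecord D ι c a s P 𝒵 dom Jc V mI L) (measOp T ((Tor (unitMod (D.F.P D.K)) × Fin (D.F.P D.K).d) × o) ι' Ω 𝒴)
          (opA_mem_measOp_slotsOfRecord D ι c a s P 𝒵 dom Jc V mI L hbdA hmQA hmRA)
        (opB_mem_measOp_slotsOfRecord D ι c a s P 𝒵 dom Jc V mI L hbdB hmQB hmRB)).act Dt
      (ballClass (selfCtr
        (assemblyOn (restrict (slotsOfRecord D ι c a s P 𝒵 dom Jc V mI L) (measOp T ((Tor (unitMod (D.F.P D.K)) × Fin (D.F.P D.K).d) × o) ι' Ω 𝒴)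
            (opA_mem_measOp_slotsOfRecord D ι c a s P 𝒵 dom Jc V mI L hbdA hmQA hmRA)
          (opB_mem_measOp_slotsOfRecord D ι c a s P 𝒵 dom Jc V mI L hbdB hmQB hmRB))).raw
        (assemblyOn (restrict (slotsOfRecord D ι c a s P 𝒵 dom Jc V mI L) (measOp T ((Tor (unitMod (D.F.P D.K)) × Fin (D.F.P D.K).d) × o) ι' Ω 𝒴)
            (opA_mem_measOp_slotsOfRecord D ι c a s P 𝒵 dom Jc V mI L hbdA hmQA hmRA)
          (opB_mem_measOp_slotsOfRecord D ι c a s P 𝒵 dom Jc V mI L hbdB hmQB hmRB))).histRef) ROp RHist) W)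
    (hN : ActExpNormBound (labelsIndexing (domainGeometry D.toTwoRuns) (b13InnerData D.toTwoRuns)) Dt
      (ballClass (selfCtr
        (assemblyOn (restrict (slotsOfRecord D ι c a s P 𝒵 dom Jc V mI L) (measOp T ((Tor (unitMod (D.F.P D.K)) × Fin (D.F.P D.K).d) × o) ι' Ω 𝒴)
            (opA_mem_measOp_slotsOfRecord D ι c a s P 𝒵 dom Jc V mI L hbdA hmQA hmRA)
          (opB_mem_measOp_slotsOfRecord D ι c a s P 𝒵 dom Jc V mI L hbdB hmQB hmRB))).raw
        (assemblyOn (restrict (slotsOfRecord D ι c a s P 𝒵 dom Jc V mI L) (measOp T ((Tor (unitMod (D.F.P D.K)) × Fin (D.F.P D.K).d) × o) ι' Ω 𝒴)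
            (opA_mem_measOp_slotsOfRecord D ι c a s P 𝒵 dom Jc V mI L hbdA hmQA hmRA)
          (opB_mem_measOp_slotsOfRecord D ι c a s P 𝒵 dom Jc V mI L hbdB hmQB hmRB))).histRef) ROp RHist) W
      L.rHist N)
    (hN0 : ∀ k g U Z ℓ, 0 ≤ N k g U Z ℓ) (hNle : ∀ k g U Z ℓ, N k g U Z ℓ ≤ Nbar) (hNbar : 0 ≤ Nbar)
    (habs : ActAbsBound (labelsIndexing (domainGeometry D.toTwoRuns) (b13InnerData D.toTwoRuns)) Dt
      (ballClass (selfCtr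
        (assemblyOn (restrict (slotsOfRecord D ι c a s P 𝒵 dom Jc V mI L) (measOp T ((Tor (unitMod (D.F.P D.K)) × Fin (D.F.P D.K).d) × o) ι' Ω 𝒴)
            (opA_mem_measOp_slotsOfRecord D ι c a s P 𝒵 dom Jc V mI L hbdA hmQA hmRA)
          (opB_mem_measOp_slotsOfRecord D ι c a s P 𝒵 dom Jc V mI L hbdB hmQB hmRB))).raw
        (assemblyOn (restrict (slotsOfRecord D ι c a s P 𝒵 dom Jc V mI L) (measOp T ((Tor (unitMod (D.F.P D.K)) × Fin (D.F.P D.K).d) × o) ι' Ω 𝒴)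
            (opA_mem_measOp_slotsOfRecord D ι c a s P 𝒵 dom Jc V mI L hbdA hmQA hmRA)
          (opB_mem_measOp_slotsOfRecord D ι c a s P 𝒵 dom Jc V mI L hbdB hmQB hmRB))).histRef) ROp RHist) W A)
    (hA0 : ∀ k g U Z ℓ, 0 ≤ A k g U Z ℓ) (hA0' : ∀ k g U Z ℓ, 0 ≤ A' k g U Z ℓ) (hκ : 0 ≤ κ)
    (hdec : ∀ k g U Z ℓ, A k g U Z ℓ ≤ A' k g U Z ℓ * Real.exp (-(κ * (D.toTwoRuns.carriers.d Z + 5))))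
    (hε : 0 ≤ ε)
    (h238 : ∀ k, ∀ g ∈ W, ∀ (U : D.toTwoRuns.carriers.BgB), ∀ Z ∈ D.toTwoRuns.domAt k,
      actSum (b13InnerData D.toTwoRuns) (A' k g U) k Z ≤ ε * Real.exp (-(Rt * D.toTwoRuns.carriers.d Z)))
    (hRt : 64 * Real.log 162 + 64 ≤ Rt) (hΦsmall : 36 * (ε * Real.exp 64 * B12TreeDecay.K₀ (4 * 2 ^ 4) (2 * 4)) < 1)
    (hOp : ∀ k, c₁ / r₀ * L.rOp k ≤ ROp k) (hHist : ∀ k, (assembly (slotsOfRecord D ι c a s P 𝒵 dom Jc V mI L)).bHist E₀ cB k ≤ RHist k)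
    (hHistA : ∀ k, (Gi * δI / (1 - ρ₁) + 2 * Gi / θ ^ k₁) * L.rHist k + EA₀ * (L.rHist k * (cA / (1 - L.ins.ω))) ≤ RHist k)
    (hEA₀ : 0 ≤ EA₀) (hE₀ : 0 ≤ E₀) (hE₁ : 0 < E₁) (hcA : 0 ≤ cA) (hcB : 0 ≤ cB)
    (hc₁ : 0 ≤ c₁) (hr₀ : 0 < r₀) (hθ0 : 0 < θ) (hθθ' : θ ≤ θ') (hθ'1 : θ' ≤ 1) (hω : 0 < L.ins.ω)
    (hω1 : L.ins.ω < 1) (hρ₀ : 0 ≤ ρ₀) (hρ₀1 : ρ₀ < 1) (hreach : c₁ / r₀ * θ ^ k₀ ≤ ρ₀) (hB : 0 ≤ B)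
    (hfirst : ∀ k < k₀, EA₀ + E₀ ≤ B * θ ^ k)
    (hsmall : L.ins.ω + 2 * (Nbar * ((ε * Real.exp 64 * B12TreeDecay.K₀ (4 * 2 ^ 4) (2 * 4)) /
          (1 - 36 * (ε * Real.exp 64 * B12TreeDecay.K₀ (4 * 2 ^ 4) (2 * 4))) ^ 2)) * cA < θ') :
    NE5 (B13StepOfRecord.outA (slotsOfRecord D ι c a s P 𝒵 dom Jc V mI L) E₀ cB)
      (B13StepOfRecord.outB (slotsOfRecord D ι c a s P 𝒵 dom Jc V mI L) E₀ cB) W κ θ'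
      (((1 / (1 - ρ₀) * ((εop * Real.exp 64 * B12TreeDecay.K₀ (4 * 2 ^ 4) (2 * 4)) /
          (1 - 36 * (εop * Real.exp 64 * B12TreeDecay.K₀ (4 * 2 ^ 4) (2 * 4))) ^ 2)) * (c₁ / r₀) +
        2 * (Nbar * ((ε * Real.exp 64 * B12TreeDecay.K₀ (4 * 2 ^ 4) (2 * 4)) /
          (1 - 36 * (ε * Real.exp 64 * B12TreeDecay.K₀ (4 * 2 ^ 4) (2 * 4))) ^ 2)) *
          (Gi * δI / (1 - ρ₁) + 2 * Gi / θ ^ k₁) + B) * (θ' - L.ins.ω) /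
        (θ' - (L.ins.ω + 2 * (Nbar * ((ε * Real.exp 64 * B12TreeDecay.K₀ (4 * 2 ^ 4) (2 * 4)) /
          (1 - 36 * (ε * Real.exp 64 * B12TreeDecay.K₀ (4 * 2 ^ 4) (2 * 4))) ^ 2)) * cA))) :=
  ne5_of_record_restrict_secant_structural (slotsOfRecord D ι c a s P 𝒵 dom Jc V mI L)
    (measOp T ((Tor (unitMod (D.F.P D.K)) × Fin (D.F.P D.K).d) × o) ι' Ω 𝒴)
    (opA_mem_measOp_slotsOfRecord D ι c a s P 𝒵 dom Jc V mI L hbdA hmQA hmRA)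
    (opB_mem_measOp_slotsOfRecord D ι c a s P 𝒵 dom Jc V mI L hbdB hmQB hmRB) E₀ cB rI hrI
    (transportReads_slotsOfRecord_of_factor D ι c a s P 𝒵 dom Jc V mI L iopAt hiopA W) hbB hbA hdA hdB hRA hRB
    hwer hfl hcomp hIA hirate hδI hGi hρ₁ hreachI hfib hAop0 hAop0' hdecop hεop h238op hΦopsmall hexp hN hN0 hNle hNbar habs hA0 hA0' hκ
    hdec hε h238 hRt hΦsmall hOp hHist hHistA hEA₀ hE₀ hE₁ hcA hcB hc₁ hr₀ hθ0 hθθ' hθ'1 hω hω1 hρ₀ hρ₀1 hreach hB hfirst hsmall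

end Instance
end Letters

/-! ## §4 The η-uniform form at the instance: one constant for every driven two-run object and every letter package -/

/-- [folklore] **E8[rec] AT THE SUBSTRATE's O1 INSTANCE WITH A CONSTANT UNIFORM IN THE PAIR OF RUNS AND THE LETTERS** (p219431 §2
`uniform_ne5_of_record_restrict_secant_structural` at the instance).  Fix the displayed SIZES exactly as there; then ONE constant `C₅` serves EVERY
driven two-run object `D : DrivenRuns G`, representation `ι`, letters `c a s`, frame `P`, factor index data `𝒵 dom Jc V mI`, EVERY letter package
`L : SlotLetters …` with `L.ins.ω = ω` satisfying §1's six letter conditions and §2's factorisation, and every window ∕ radii ∕ majorants ∕ datum ∕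
insertion-composition data: §3's displayed binders IMPLY `NE5 (B13StepOfRecord.outA (slotsOfRecord …) E₀ cB) (B13StepOfRecord.outB (slotsOfRecord …)
E₀ cB) W κ θ′ C₅` (quantifier order `∃ C₅, ∀ D … L W …`).  NOT a proof of NE5: an implication from displayed binders about the substrate's letters. -/
theorem uniform_ne5_of_substrate_restrict_secant_structural {κ Nbar ε εop Rt EA₀ E₀ cA cB c₁ r₀ Gi δI ρ₁ θ θ' ω ρ₀ : ℝ} {k₁ : ℕ}
    (hκ : 0 ≤ κ) (hNbar : 0 ≤ Nbar) (hε : 0 ≤ ε) (hεop : 0 ≤ εop) (hRt : 64 * Real.log 162 + 64 ≤ Rt)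
    (hΦsmall : 36 * (ε * Real.exp 64 * B12TreeDecay.K₀ (4 * 2 ^ 4) (2 * 4)) < 1)
    (hΦopsmall : 36 * (εop * Real.exp 64 * B12TreeDecay.K₀ (4 * 2 ^ 4) (2 * 4)) < 1)
    (hEA₀ : 0 ≤ EA₀) (hE₀ : 0 ≤ E₀) (hcA : 0 ≤ cA) (hcB : 0 ≤ cB) (hc₁ : 0 ≤ c₁) (hr₀ : 0 < r₀)
    (hGi : 0 ≤ Gi) (hδI : 0 ≤ δI) (hρ₁ : ρ₁ < 1) (hreachI : δI * θ ^ k₁ ≤ ρ₁)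
    (hθ0 : 0 < θ) (hθ1 : θ < 1) (hθθ' : θ ≤ θ') (hθ'1 : θ' ≤ 1) (hω : 0 < ω) (hω1 : ω < 1) (hρ₀ : 0 < ρ₀) (hρ₀1 : ρ₀ < 1)
    (hsmall : ω + 2 * (Nbar * ((ε * Real.exp 64 * B12TreeDecay.K₀ (4 * 2 ^ 4) (2 * 4)) /
          (1 - 36 * (ε * Real.exp 64 * B12TreeDecay.K₀ (4 * 2 ^ 4) (2 * 4))) ^ 2)) * cA < θ') :
    ∃ C₅ : ℝ, ∀ {G : Type} [GaugeGroup G] (D : DrivenRuns G) {o : Type} [Fintype o] [DecidableEq o] (ι : G →* Matrix o o ℂ) (c : ℂ)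
      (a : ℝ) (s : ℕ → ℂ) {T ι' S Ω 𝒴 : Type} [MeasurableSpace Ω] (P : MeasPotFrame D.carriers) {IOp : Type*} [NormedAddCommGroup IOp]
      [NormedSpace ℂ IOp] (𝒵 : D.carriers.Dom → InnerLabel D.carriers.Dom (Bnd D.toTwoRuns) → Type) [∀ Z j, Fintype (𝒵 Z j)]
      (dom : ∀ Z j, 𝒵 Z j → D.carriers.Dom) (Jc : D.carriers.Dom → InnerLabel D.carriers.Dom (Bnd D.toTwoRuns) → Type)
      [∀ Z j, Fintype (Jc Z j)] (V : D.carriers.Dom → InnerLabel D.carriers.Dom (Bnd D.toTwoRuns) → Type)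
      [∀ Z j, NormedAddCommGroup (V Z j)] [∀ Z j, InnerProductSpace ℝ (V Z j)] [∀ Z j, MeasurableSpace (V Z j)] [∀ Z j, BorelSpace (V Z j)]
      [∀ Z j, FiniteDimensional ℝ (V Z j)] (mI : D.carriers.Dom → InnerLabel D.carriers.Dom (Bnd D.toTwoRuns) → Type)
      [∀ Z j, Fintype (mI Z j)] [∀ Z j, DecidableEq (mI Z j)]
      (L : SlotLetters D (o := o) (T := T) (ι' := ι') (S := S) (Ω := Ω) (𝒴 := 𝒴) P (IOp := IOp) 𝒵 dom Jc V mI)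
      (hbdA : ∀ (g : ℕ → ℝ) (U : D.carriers.BgA) (k : ℕ),
        FormatBounded (L.W k).format (rawAOfRecord ι D c a s L.ΓA L.dkA L.gcA L.pQA L.pRA g U k).kernel)
      (hmQA : ∀ (r : ℝ) (U : GaugeField (D.F.P D.K) 0 G) (k : ℕ) (Y : 𝒴) (b b' : ((Tor (unitMod (D.F.P D.K)) × Fin (D.F.P D.K).d) × o)),
        Measurable fun x : Ω => L.pQA r U k x Y b b')
      (hmRA : ∀ (r : ℝ) (U : GaugeField (D.F.P D.K) 0 G) (k : ℕ) (Y : 𝒴), Measurable fun x : Ω => L.pRA r U k x Y)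
      (hbdB : ∀ (g : ℕ → ℝ) (U : D.carriers.BgB) (k : ℕ),
        FormatBounded (L.W k).format (rawBOfRecord ι D c a s L.ΓB L.dkB L.gcB L.pQB L.pRB g U k).kernel)
      (hmQB : ∀ (r : ℝ) (U : GaugeField (D.F.P (D.K + 1)) 0 G) (k : ℕ) (Y : 𝒴) (b b' : ((Tor (unitMod (D.F.P D.K)) × Fin (D.F.P D.K).d) × o)),
        Measurable fun x : Ω => L.pQB r U k x Y b b')
      (hmRB : ∀ (r : ℝ) (U : GaugeField (D.F.P (D.K + 1)) 0 G) (k : ℕ) (Y : 𝒴), Measurable fun x : Ω => L.pRB r U k x Y)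
      (iopAt : ℝ → D.carriers.BgA → ℕ → IOp)
      (hiopA : ∀ (r : ℝ) (U : D.carriers.BgB) (k : ℕ), L.ins.iopA r U k = iopAt r (D.carriers.transport U) k)
      {W : Set (ℕ → ℝ)} {ROp RHist : ℕ → ℝ}
      {N A A' Aop Aop' : ℕ → (ℕ → ℝ) → D.toTwoRuns.carriers.BgB → D.toTwoRuns.carriers.Dom →
        InnerLabel D.toTwoRuns.carriers.Dom (Bnd D.toTwoRuns) → ℝ}
      {Dt : ActData D.toTwoRuns.carriers.Dom (InnerLabel D.toTwoRuns.carriers.Dom (Bnd D.toTwoRuns))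
        (measOp T ((Tor (unitMod (D.F.P D.K)) × Fin (D.F.P D.K).d) × o) ι' Ω 𝒴) (B13HistM P) Ω} {rI : ℕ → ℝ} {hrI : ∀ k, 0 < rI k}
      {Cfg : ℕ → Type*} [∀ k, NormedAddCommGroup (Cfg k)] [∀ k, NormedSpace ℂ (Cfg k)] {cfg : ∀ k, IOp → Cfg k}
      {Φ : ∀ k, (D.toTwoRuns.carriers.Dom → ℝ) → Cfg k → B13HistM P} {𝒪 : ℕ → (ℕ → ℝ) → D.toTwoRuns.carriers.BgB → Set IOp}
      {Dc : ∀ k, (ℕ → ℝ) → D.toTwoRuns.carriers.BgB → Set (Cfg k)},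
      L.ins.ω = ω →
      (assembly (slotsOfRecord D ι c a s P 𝒵 dom Jc V mI L)).SliceBudgetB W κ cB →
      (slotsOfRecord D ι c a s P 𝒵 dom Jc V mI L).D.SliceBudget (step (slotsOfRecord D ι c a s P 𝒵 dom Jc V mI L) E₀ cB) W κ cA →
      DecayBound (B13StepOfRecord.outA (slotsOfRecord D ι c a s P 𝒵 dom Jc V mI L) E₀ cB) W EA₀ κ →
      DecayBound (B13StepOfRecord.outB (slotsOfRecord D ι c a s P 𝒵 dom Jc V mI L) E₀ cB) W E₀ κ →
      RawBounded (slotsOfRecord D ι c a s P 𝒵 dom Jc V mI L).F (assembly (slotsOfRecord D ι c a s P 𝒵 dom Jc V mI L)).rawAt W →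
      RawBounded (slotsOfRecord D ι c a s P 𝒵 dom Jc V mI L).F (slotsOfRecord D ι c a s P 𝒵 dom Jc V mI L).rawB W →
      WeightedEntrywiseRate (slotsOfRecord D ι c a s P 𝒵 dom Jc V mI L).F (assembly (slotsOfRecord D ι c a s P 𝒵 dom Jc V mI L)).rawAt
          (slotsOfRecord D ι c a s P 𝒵 dom Jc V mI L).rawB W c₁ (fun k => θ ^ k) → (∀ k, r₀ ≤ L.rOp k) →
      InsOpComposition ((slotsOfRecord D ι c a s P 𝒵 dom Jc V mI L).D.toInsOpModel (step (slotsOfRecord D ι c a s P 𝒵 dom Jc V mI L) E₀ cB) rI hrI)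
          W κ E₀ Gi cfg Φ 𝒪 Dc →
      (∀ k, ∀ g ∈ W, ∀ (U : D.toTwoRuns.carriers.BgB),
        ((slotsOfRecord D ι c a s P 𝒵 dom Jc V mI L).D.toInsOpModel (step (slotsOfRecord D ι c a s P 𝒵 dom Jc V mI L) E₀ cB)
          rI hrI).opIA g U k ∈ 𝒪 k g U) →
      ((slotsOfRecord D ι c a s P 𝒵 dom Jc V mI L).D.toInsOpModel (step (slotsOfRecord D ι c a s P 𝒵 dom Jc V mI L) E₀ cB) rI hrI).InsOpRate W δI θ →
      ActOpFibre (labelsIndexing (domainGeometry D.toTwoRuns) (b13InnerData D.toTwoRuns))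
        (restrict (slotsOfRecord D ι c a s P 𝒵 dom Jc V mI L) (measOp T ((Tor (unitMod (D.F.P D.K)) × Fin (D.F.P D.K).d) × o) ι' Ω 𝒴)
          (opA_mem_measOp_slotsOfRecord D ι c a s P 𝒵 dom Jc V mI L hbdA hmQA hmRA) (opB_mem_measOp_slotsOfRecord D ι c a s P 𝒵 dom Jc V mI L hbdB
            hmQB hmRB)).act
        (stepOn (restrict (slotsOfRecord D ι c a s P 𝒵 dom Jc V mI L) (measOp T ((Tor (unitMod (D.F.P D.K)) × Fin (D.F.P D.K).d) × o) ι' Ω 𝒴)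
          (opA_mem_measOp_slotsOfRecord D ι c a s P 𝒵 dom Jc V mI L hbdA hmQA hmRA) (opB_mem_measOp_slotsOfRecord D ι c a s P 𝒵 dom Jc V mI L hbdB
            hmQB hmRB)) E₀ cB) W Aop →
      (∀ k g U Z ℓ, 0 ≤ Aop k g U Z ℓ) → (∀ k g U Z ℓ, 0 ≤ Aop' k g U Z ℓ) →
      (∀ k g U Z ℓ, Aop k g U Z ℓ ≤ Aop' k g U Z ℓ * Real.exp (-(κ * (D.toTwoRuns.carriers.d Z + 5)))) →
      (∀ k, ∀ g ∈ W, ∀ (U : D.toTwoRuns.carriers.BgB), ∀ Z ∈ D.toTwoRuns.domAt k,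
        actSum (b13InnerData D.toTwoRuns) (Aop' k g U) k Z ≤ εop * Real.exp (-(Rt * D.toTwoRuns.carriers.d Z))) →
      ActExpLinearOn (labelsIndexing (domainGeometry D.toTwoRuns) (b13InnerData D.toTwoRuns))
        (restrict (slotsOfRecord D ι c a s P 𝒵 dom Jc V mI L) (measOp T ((Tor (unitMod (D.F.P D.K)) × Fin (D.F.P D.K).d) × o) ι' Ω 𝒴)
          (opA_mem_measOp_slotsOfRecord D ι c a s P 𝒵 dom Jc V mI L hbdA hmQA hmRA) (opB_mem_measOp_slotsOfRecord D ι c a s P 𝒵 dom Jc V mI L hbdB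
            hmQB hmRB)).act Dt
        (ballClass (selfCtr
          (assemblyOn (restrict (slotsOfRecord D ι c a s P 𝒵 dom Jc V mI L) (measOp T ((Tor (unitMod (D.F.P D.K)) × Fin (D.F.P D.K).d) × o) ι' Ω 𝒴)
            (opA_mem_measOp_slotsOfRecord D ι c a s P 𝒵 dom Jc V mI L hbdA hmQA hmRA) (opB_mem_measOp_slotsOfRecord D ι c a s P 𝒵 dom Jc V mI L hbdB
              hmQB hmRB))).raw
          (assemblyOn (restrict (slotsOfRecord D ι c a s P 𝒵 dom Jc V mI L) (measOp T ((Tor (unitMod (D.F.P D.K)) × Fin (D.F.P D.K).d) × o) ι' Ω 𝒴)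
            (opA_mem_measOp_slotsOfRecord D ι c a s P 𝒵 dom Jc V mI L hbdA hmQA hmRA) (opB_mem_measOp_slotsOfRecord D ι c a s P 𝒵 dom Jc V mI L hbdB
              hmQB hmRB))).histRef) ROp RHist) W →
      ActExpNormBound (labelsIndexing (domainGeometry D.toTwoRuns) (b13InnerData D.toTwoRuns)) Dt
        (ballClass (selfCtr
          (assemblyOn (restrict (slotsOfRecord D ι c a s P 𝒵 dom Jc V mI L) (measOp T ((Tor (unitMod (D.F.P D.K)) × Fin (D.F.P D.K).d) × o) ι' Ω 𝒴)
            (opA_mem_measOp_slotsOfRecord D ι c a s P 𝒵 dom Jc V mI L hbdA hmQA hmRA) (opB_mem_measOp_slotsOfRecord D ι c a s P 𝒵 dom Jc V mI L hbdB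
              hmQB hmRB))).raw
          (assemblyOn (restrict (slotsOfRecord D ι c a s P 𝒵 dom Jc V mI L) (measOp T ((Tor (unitMod (D.F.P D.K)) × Fin (D.F.P D.K).d) × o) ι' Ω 𝒴)
            (opA_mem_measOp_slotsOfRecord D ι c a s P 𝒵 dom Jc V mI L hbdA hmQA hmRA) (opB_mem_measOp_slotsOfRecord D ι c a s P 𝒵 dom Jc V mI L hbdB
              hmQB hmRB))).histRef) ROp RHist) W
        L.rHist N →
      (∀ k g U Z ℓ, 0 ≤ N k g U Z ℓ) → (∀ k g U Z ℓ, N k g U Z ℓ ≤ Nbar) →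
      ActAbsBound (labelsIndexing (domainGeometry D.toTwoRuns) (b13InnerData D.toTwoRuns)) Dt
        (ballClass (selfCtr
          (assemblyOn (restrict (slotsOfRecord D ι c a s P 𝒵 dom Jc V mI L) (measOp T ((Tor (unitMod (D.F.P D.K)) × Fin (D.F.P D.K).d) × o) ι' Ω 𝒴)
            (opA_mem_measOp_slotsOfRecord D ι c a s P 𝒵 dom Jc V mI L hbdA hmQA hmRA) (opB_mem_measOp_slotsOfRecord D ι c a s P 𝒵 dom Jc V mI L hbdB
              hmQB hmRB))).raw
          (assemblyOn (restrict (slotsOfRecord D ι c a s P 𝒵 dom Jc V mI L) (measOp T ((Tor (unitMod (D.F.P D.K)) × Fin (D.F.P D.K).d) × o) ι' Ω 𝒴)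
            (opA_mem_measOp_slotsOfRecord D ι c a s P 𝒵 dom Jc V mI L hbdA hmQA hmRA) (opB_mem_measOp_slotsOfRecord D ι c a s P 𝒵 dom Jc V mI L hbdB
              hmQB hmRB))).histRef) ROp RHist) W A →
      (∀ k g U Z ℓ, 0 ≤ A k g U Z ℓ) → (∀ k g U Z ℓ, 0 ≤ A' k g U Z ℓ) →
      (∀ k g U Z ℓ, A k g U Z ℓ ≤ A' k g U Z ℓ * Real.exp (-(κ * (D.toTwoRuns.carriers.d Z + 5)))) →
      (∀ k, ∀ g ∈ W, ∀ (U : D.toTwoRuns.carriers.BgB), ∀ Z ∈ D.toTwoRuns.domAt k,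
        actSum (b13InnerData D.toTwoRuns) (A' k g U) k Z ≤ ε * Real.exp (-(Rt * D.toTwoRuns.carriers.d Z))) →
      (∀ k, c₁ / r₀ * L.rOp k ≤ ROp k) → (∀ k, (assembly (slotsOfRecord D ι c a s P 𝒵 dom Jc V mI L)).bHist E₀ cB k ≤ RHist k) →
      (∀ k, (Gi * δI / (1 - ρ₁) + 2 * Gi / θ ^ k₁) * L.rHist k + EA₀ * (L.rHist k * (cA / (1 - ω))) ≤ RHist k) →
      NE5 (B13StepOfRecord.outA (slotsOfRecord D ι c a s P 𝒵 dom Jc V mI L) E₀ cB)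
        (B13StepOfRecord.outB (slotsOfRecord D ι c a s P 𝒵 dom Jc V mI L) E₀ cB) W κ θ' C₅ := by
  obtain ⟨C₅, h⟩ := uniform_ne5_of_record_restrict_secant_structural (k₁ := k₁) hκ hNbar hε hεop hRt hΦsmall hΦopsmall hEA₀ hE₀ hcA hcB
    hc₁ hr₀ hGi hδI hρ₁ hreachI hθ0 hθ1 hθθ' hθ'1 hω hω1 hρ₀ hρ₀1 hsmall
  refine ⟨C₅, ?_⟩
  intro G _ D o _ _ ι c a s T ι' S Ω 𝒴 _ P IOp _ _ 𝒵 _ dom Jc _ V _ _ _ _ _ mI _ _ L hbdA hmQA hmRA hbdB hmQB hmRB iopAt hiopA W ROp RHist N A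
    A' Aop Aop' Dt rI hrI Cfg _ _ cfg Φ 𝒪 Dc hLω hbB hbA hdA hdB hRA hRB hwer hfl hcomp hIA hirate hfib hAop0 hAop0' hdecop h238op hexp hN
    hN0 hNle habs hA0 hA0' hdec h238 hOp hHist hHistA
  exact h (slotsOfRecord D ι c a s P 𝒵 dom Jc V mI L) (measOp T ((Tor (unitMod (D.F.P D.K)) × Fin (D.F.P D.K).d) × o) ι' Ω 𝒴)
    (opA_mem_measOp_slotsOfRecord D ι c a s P 𝒵 dom Jc V mI L hbdA hmQA hmRA)
    (opB_mem_measOp_slotsOfRecord D ι c a s P 𝒵 dom Jc V mI L hbdB hmQB hmRB) hLω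
    (transportReads_slotsOfRecord_of_factor D ι c a s P 𝒵 dom Jc V mI L iopAt hiopA W) hbB hbA hdA hdB hRA hRB hwer hfl hcomp hIA hirate
    hfib hAop0 hAop0' hdecop h238op hexp hN hN0 hNle habs hA0 hA0' hdec h238 hOp hHist hHistA

end Summit.QuantumFields.BalabanUV.T4Continuum.B13StepOfRecordSubstrate

end
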